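import Summits.QuantumFields.BalabanUV.Beta.GAN24.T2SlotUnits

/-!
# `BalabanUV.Beta.GAN24.WSlotT2OfPieces` — binder row G-an2-4 / (CONV-C), W-slot, road «W3» (SKELETON-W3 v0.2 §7.4 (F5)):
# «T2Shape» AND «T2Drift»∕«T2SupRate» AS FUNCTIONS OF THE FIVE ROW FAMILIES — END #1 and END #2 of road «W3»
# (row owner b2b-balaban-gan24-p1, gen 5)

NOT IN PRINT; OUR PROOF ATTEMPT.  HONEST FRAMING (cell contract, verbatim): «discharging `BetaPertH` makes Bałaban's UV stability
UNCONDITIONAL — a real constructive-QFT result; it is NOT the continuum limit and NOT the Clay problem.»  HONEST DEPENDENCY (verbatim):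
«continuum YM on T⁴ ⇐ BetaPertH ∧ nine spine estimates (0/9 proved); BetaPertH ⇐ (D1) ∧ (D4) ∧ CAP+tail; G-an2-4 gates asym, D1 and
NE2/3/4.»

WHAT.  After the K-slot (`KSlotAssembly.convCKWall_holds`) and the S-slot (`StencilSlotSThree.hS_three`, `StencilSlotSAllThree`), the wall for the
Bałaban jets needs an2's two W-rows ALONE (`StencilSlotWallThree.d1Drift_JsBalOf_iff_three_of_wRows`); for an2's Stage-B family these are
EQUIVALENT (leaf-19's `T2SlotOfHW.hW_iff_t2Shape`, leaf-07's `WSlotOfShapes`, leaf-01's `WSlotSupRate`) to the located pair on the NORMALISED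
recursive bi-stencil family `T♮_j := unitS₂ (sfStep Lc j) (smStep d Lc j) (T2Of … j)` (leaf-19's `T2SlotUnits`):
  «T2Shape»  `∃ C₂ δ₂, 0 < δ₂ ∧ ∀ j, LocStencil₂ T♮_j C₂ δ₂`,      «T2Drift»  `∃ c ϑ δ₂, … ∧ ∀ k j, LocStencil₂ (T♮_{k+j} − T♮_k) (c·ϑ^k) δ₂`.
Road «W3» (`HOME/b2b-balaban-gan24-p1/SKELETON-W3.md` v0.2) writes the normalised recursion as the AFFINE tower `T♮_{j+1} = 𝒜_j[T♮_j] + b_j`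
(leaf-04's `T2RecursionAffine.unitS₂_T2Of_succ_affine`: `𝒜_j = lin4 (cE₂·Lc^{2(d+1)}) K♮_j Lc`), whose linear part has the level-independent
zero-mode eigenvalue `−cE₂·Lc^{−(d+5)}` (leaf-16 kit j090038, leaf-18's count) — classical marginality of the quartic vertex in four
dimensions: NO one-step estimate iterated in `j` can close.  THIS module is the order-four twin of the S-slot's END-as-function modules
(`StencilSlotE3OfPieces`/`…RateOfPieces`): it FIXES THE ROW TEXTS by proving the two located shapes AS FUNCTIONS of the five row families
of SKELETON-W3 §7.4, in a form that names NO carrier — the transport `P m k` (the `k`-fold composite of the linear parts from level `m`),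
the zero-mode predicate `Zfree` and the first-moment functional `mom` are PARAMETERS, instantiated by the row files (`T2RecursionAffine.lin4`
iterated; leaf-02's `BiStencilZeroMode.zmode … = 0`; the weighted `ℓ¹` moment):
* (F1) FLATTENING `hsplit : T n = P 0 n (T 0) + Σ_{i<n} P (i+1) (n−1−i) (b i)` (the unrolled affine recursion);
* (F3) TRANSPORT  `hTmarg` — the MARGINAL bound: `P m k` maps `LocStencil₂ (C, δ_in)` into `LocStencil₂ (C_T·C, δ_T)` uniformly in `(m, k)`,
  stated UNDER THE PIN `|cE₂| ≤ Lc^{2(d+1)}` (|ĉ| ≤ 1; the row is false without it) — and `hTirr` — the IRRELEVANT bound: on zero-mode-free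
  tables with first moment `≤ C` the transport GAINS `ρ^k`, `0 ≤ ρ < 1` (expected `ρ = Lc⁻¹`: one Taylor order against the block-smooth
  composite legs);
* (F2) ZERO MODES `hZ : ∀ m, Zfree (b m)` (the level-`m` zero-mode calculus: (Q-lin), (S2c), (S3c) of SKELETON-W3 §7.2);
* (F4) ONE-SHOT DATA `hb : ∀ m, LocStencil₂ (b m) C_b δ_in ∧ mom (b m) ≤ C_b` (an2's one-shot bricks at one fixed rate; K-slot ✓,
  «E3Shape» ✓, M∕M₂ `j`-free ✓), and for END #2 the forcing of the DIFFERENCE recursion `hf : … (C_f·θ^m) …` (leaf-03's Lipschitz engine ×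
  the Cauchy data `CauchyDecayK` ✓ ∕ `SpureUnitDrift` ✓).
RESULTS ([folklore] real analysis — geometric series, Bernoulli's inequality — and `LocStencil₂` bookkeeping; generic `d`):
* §0 `locStencil₂_zero`, `locStencil₂_add`, `locStencil₂_mono`, `locStencil₂_sum`, `geom_reflect_sum_le`, `exists_geom_dominate`,
  `conv_sum_le`;
* §1 **`shape_of_rows`** (END #1, generic tower): `∀ n, LocStencil₂ (T n) (C_T·C₀ + C_T′·C_b·(1−ρ)⁻¹) δ_T`;
* §2 **`rate_of_rows`** (END #2, generic tower of DIFFERENCES, every term zero-mode-free): `∃ c ϑ, 0 ≤ c ∧ 0 < ϑ ∧ ϑ < 1 ∧ ∀ n,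
  LocStencil₂ (D n) (c·ϑ^n) δ_T`; `cauchy_of_rate` (telescoping: `∀ k j, LocStencil₂ (T (k+j) − T k) (c·(1−ϑ)⁻¹·ϑ^k) δ`);
* §3 THE LITERAL W-SLOT SHAPES for an2's Stage-B tables `T2Of d Lc cE cVH cΛ cE₂ cB T (vh₂S d Lc) mixFF`: **`t2Shape_of_rows`** (= leaf-07's
  binder `hT₂` of `WSlotOfShapes.hW_of_shapes` ∕ leaf-19's «T2Shape» side of `hW_iff_t2Shape`, token for token, UNDER `hpin`) and
  **`t2Drift_of_rows`** (one-step form + Cauchy form + the entrywise sup-rate «T2SupRate» of leaf-01's route).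
HONEST: compositions of HYPOTHESES; every row family is OPEN (F1 leaf-04∕leaf-17∕leaf-01 lineages, F2 leaf-02∕leaf-10∕leaf-18, F3 the crux,
F4 leaf-03∕07∕19); the pin `hpin` is an HYPOTHESIS until an2's (P6) discharges it BY NAME (ref2 r47 (r)); 0 `def`, 0 `def … : Prop`, 0 cite,
0 sorry; asserts NO shape of Bałaban's tables; discharges NOTHING of (hW, hWall); NOT «W-slot closed», NEVER «G-an2-4 closed», NOT (CONV-C);
NOT BetaPertH, NOT continuum, NOT Clay.
-/

noncomputable section

open Finset
open scoped BigOperators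
open Literature.MathematicalPhysics.QuantumFieldTheory
open Literature.MathematicalPhysics.QuantumFieldTheory.Balaban1983to89
open Literature.MathematicalPhysics.QuantumFieldTheory.Balaban1983to89.Beta
open B12Sec2to5 (l1 l1_nonneg)
open ExpKernelCalculus (MKer BiLoc)
open OneStepResolventKernel (Fib)
open BalabanCompositeJets (LocStencil₂)
open KernelWard (biLoc_add)
open BalabanStepW2 (T2Of)
open AveragingMixedJetTables (vh₂S)
open Summit.QuantumFields.BalabanUV.Beta.SecondOrderUnits (unitS₂)
open Summit.QuantumFields.BalabanUV.Beta.GAN24.CombesThomas (sfStep smStep)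

namespace Summit.QuantumFields.BalabanUV.Beta.GAN24.WSlotT2OfPieces

variable {d : ℕ}

/-! ## §0 `LocStencil₂` bookkeeping and the two pieces of real arithmetic -/

section Bookkeeping

/-- [folklore] The zero bi-table is a `LocStencil₂` family with constant `0` (any rate). -/
theorem locStencil₂_zero (δ : ℝ) :
    LocStencil₂ (0 : Fin (d + 1) → (Fin (d + 1) → ℤ) → Fin (d + 1) → (Fin (d + 1) → ℤ) → MKer (d + 1) (Fib d)) 0 δ := by
  intro κ u κ' u' x z a b
  simp only [Pi.zero_apply, abs_zero, zero_mul]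
  exact le_rfl

/-- [folklore] Sum of two `LocStencil₂` families (pointwise `+` of the tables; an2's `locStencil₂_add'` in `Pi` form). -/
theorem locStencil₂_add {A B : Fin (d + 1) → (Fin (d + 1) → ℤ) → Fin (d + 1) → (Fin (d + 1) → ℤ) → MKer (d + 1) (Fib d)}
    {C₁ C₂ δ : ℝ} (hA : LocStencil₂ A C₁ δ) (hB : LocStencil₂ B C₂ δ) : LocStencil₂ (A + B) (C₁ + C₂) δ := by
  intro κ u κ' u'
  rw [show (A + B) κ u κ' u' = A κ u κ' u' + B κ u κ' u' from rfl, add_mul]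
  exact biLoc_add (hA κ u κ' u') (hB κ u κ' u')

/-- [folklore] Enlarging the constant of a `LocStencil₂` family. -/
theorem locStencil₂_mono {A : Fin (d + 1) → (Fin (d + 1) → ℤ) → Fin (d + 1) → (Fin (d + 1) → ℤ) → MKer (d + 1) (Fib d)}
    {C C' δ : ℝ} (hA : LocStencil₂ A C δ) (hC : C ≤ C') : LocStencil₂ A C' δ := by
  intro κ u κ' u' x z a b
  refine (hA κ u κ' u' x z a b).trans ?_
  exact mul_le_mul_of_nonneg_right (mul_le_mul_of_nonneg_right hC (Real.exp_nonneg _)) (Real.exp_nonneg _)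

/-- [folklore] A finite sum of `LocStencil₂` families at a common rate (constants add). -/
theorem locStencil₂_sum {ι : Type*} (s : Finset ι)
    (F : ι → Fin (d + 1) → (Fin (d + 1) → ℤ) → Fin (d + 1) → (Fin (d + 1) → ℤ) → MKer (d + 1) (Fib d)) (C : ι → ℝ) {δ : ℝ}
    (h : ∀ i ∈ s, LocStencil₂ (F i) (C i) δ) : LocStencil₂ (∑ i ∈ s, F i) (∑ i ∈ s, C i) δ := by
  classical
  induction s using Finset.induction_on with
  | empty => simpa only [Finset.sum_empty] using locStencil₂_zero (d := d) δ
  | insert i s hi ih =>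
    rw [Finset.sum_insert hi, Finset.sum_insert hi]
    exact locStencil₂_add (h i (Finset.mem_insert_self i s)) (ih fun j hj => h j (Finset.mem_insert_of_mem hj))

/-- [folklore] The reflected geometric sum is bounded by the full series: `Σ_{i<n} ρ^{n−1−i} ≤ (1 − ρ)⁻¹`. -/
theorem geom_reflect_sum_le {ρ : ℝ} (hρ0 : 0 ≤ ρ) (hρ1 : ρ < 1) (n : ℕ) :
    ∑ i ∈ Finset.range n, ρ ^ (n - 1 - i) ≤ (1 - ρ)⁻¹ := by
  rw [Finset.sum_range_reflect (fun i => ρ ^ i) n, ← tsum_geometric_of_lt_one hρ0 hρ1]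
  exact (summable_geometric_of_lt_one hρ0 hρ1).sum_le_tsum (Finset.range n) fun i _ => pow_nonneg hρ0 i

/-- [folklore] BERNOULLI: a linear factor is dominated geometrically — for `0 ≤ μ < 1` there are `c ≥ 0` and `ϑ ∈ (0, 1)` with
`(n + 1)·μ^n ≤ c·ϑ^n` for every `n` (take `ϑ = (1 + μ)/2` and `c = (1 − μ/ϑ)⁻¹` from `1 + n·a ≤ (1 + a)^n`). -/
theorem exists_geom_dominate {μ : ℝ} (hμ0 : 0 ≤ μ) (hμ1 : μ < 1) :
    ∃ c ϑ : ℝ, 0 ≤ c ∧ 0 < ϑ ∧ ϑ < 1 ∧ μ ≤ ϑ ∧ ∀ n : ℕ, ((n : ℝ) + 1) * μ ^ n ≤ c * ϑ ^ n := by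
  rcases hμ0.eq_or_lt with h | hμpos
  · -- μ = 0: (n+1)·0^n ≤ 1·(1/2)^n fails for n = 0 only if c < 1; take c = 1, ϑ = 1/2 and note 0^n = 0 for n ≥ 1
    refine ⟨1, 1 / 2, zero_le_one, by norm_num, by norm_num, by rw [← h]; norm_num, fun n => ?_⟩
    rcases n with _ | n
    · simp
    · rw [← h, zero_pow (Nat.succ_ne_zero n), mul_zero]
      positivity
  set ϑ : ℝ := (1 + μ) / 2 with hϑ
  have hϑpos : 0 < ϑ := by rw [hϑ]; linarith
  have hμϑ : μ < ϑ := by rw [hϑ]; linarith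
  have hϑ1 : ϑ < 1 := by rw [hϑ]; linarith
  set r : ℝ := μ / ϑ with hr
  have hr0 : 0 < r := div_pos hμpos hϑpos
  have hr1 : r < 1 := (div_lt_one hϑpos).2 hμϑ
  have hμr : μ = r * ϑ := by rw [hr, div_mul_cancel₀ μ hϑpos.ne']
  -- a := r⁻¹ − 1 > 0; Bernoulli: 1 + n a ≤ (1 + a)^n = (r^n)⁻¹
  set a : ℝ := r⁻¹ - 1 with ha
  have ha0 : 0 < a := by
    have : 1 < r⁻¹ := (one_lt_inv₀ hr0).2 hr1
    rw [ha]; linarith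
  refine ⟨a⁻¹ + 1, ϑ, by positivity, hϑpos, hϑ1, hμϑ.le, fun n => ?_⟩
  have hrn : 0 < r ^ n := pow_pos hr0 n
  have hB : 1 + (n : ℝ) * a ≤ (r ^ n)⁻¹ := by
    have h := one_add_mul_le_pow (show (-2 : ℝ) ≤ a by linarith) n
    rwa [show 1 + a = r⁻¹ by rw [ha]; ring, inv_pow] at h
  -- multiply by r^n: r^n + n a r^n ≤ 1, hence n r^n ≤ a⁻¹
  have h1 : r ^ n + (n : ℝ) * a * r ^ n ≤ 1 := by
    have h := mul_le_mul_of_nonneg_right hB hrn.le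
    rw [inv_mul_cancel₀ hrn.ne', add_mul, one_mul, mul_assoc] at h
    linarith
  have h2 : (n : ℝ) * r ^ n ≤ a⁻¹ := by
    rw [inv_eq_one_div, le_div_iff₀ ha0]
    nlinarith [hrn]
  have h3 : r ^ n ≤ 1 := pow_le_one₀ hr0.le hr1.le
  calc ((n : ℝ) + 1) * μ ^ n = ((n : ℝ) * r ^ n + r ^ n) * ϑ ^ n := by rw [hμr, mul_pow]; ring
    _ ≤ (a⁻¹ + 1) * ϑ ^ n := by
      refine mul_le_mul_of_nonneg_right ?_ (pow_nonneg hϑpos.le n)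
      linarith

/-- [folklore] The «convolution» of two geometric sequences: `Σ_{i<n} ρ^{n−1−i}·θ^i ≤ n·(max ρ θ)^{n−1}`. -/
theorem conv_sum_le {ρ θ : ℝ} (hρ0 : 0 ≤ ρ) (hθ0 : 0 ≤ θ) (n : ℕ) :
    ∑ i ∈ Finset.range n, ρ ^ (n - 1 - i) * θ ^ i ≤ n * (max ρ θ) ^ (n - 1) := by
  have hμ0 : 0 ≤ max ρ θ := le_max_of_le_left hρ0
  calc ∑ i ∈ Finset.range n, ρ ^ (n - 1 - i) * θ ^ i ≤ ∑ _i ∈ Finset.range n, (max ρ θ) ^ (n - 1) := by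
        refine Finset.sum_le_sum fun i hi => ?_
        have hi' : n - 1 - i + i = n - 1 := by have := Finset.mem_range.1 hi; omega
        calc ρ ^ (n - 1 - i) * θ ^ i ≤ (max ρ θ) ^ (n - 1 - i) * (max ρ θ) ^ i :=
              mul_le_mul (pow_le_pow_left₀ hρ0 (le_max_left _ _) _) (pow_le_pow_left₀ hθ0 (le_max_right _ _) _)
                (pow_nonneg hθ0 _) (pow_nonneg hμ0 _)
          _ = (max ρ θ) ^ (n - 1) := by rw [← pow_add, hi']
    _ = n * (max ρ θ) ^ (n - 1) := by rw [Finset.sum_const, Finset.card_range, nsmul_eq_mul]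

end Bookkeeping

/-! ## §1 END #1 (generic): the UNIFORM SHAPE of an affinely transported tower from the five row families -/

section Shape

/-- [folklore] **END #1 OF ROAD «W3» (generic tower).**  Let `T : ℕ → (bi-tables)` be unrolled as `T n = P 0 n (T 0) + Σ_{i<n} P (i+1) (n−1−i) (b i)`
((F1), the affine recursion `T (j+1) = 𝒜_j (T j) + b j` flattened; `P m k` = the `k`-fold transport from level `m`).  If the transport is
MARGINALLY BOUNDED on `LocStencil₂ (·, δ_in)` — constant `C_T`, output rate `δ_T`, uniformly in `(m, k)` ((F3) `hTmarg`) —, IRRELEVANT on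
zero-mode-free tables of bounded first moment — gain `ρ^k` ((F3) `hTirr`) —, every source is zero-mode-free ((F2) `hZ`) with uniform shape and
first moment ((F4) `hb`), then EVERY member is a `LocStencil₂` family with ONE constant `C_T·C₀ + C_T′·C_b·(1−ρ)⁻¹` at the rate `δ_T`.
Pure bookkeeping: `locStencil₂_sum` + the geometric series. -/
theorem shape_of_rows (T b : ℕ → Fin (d + 1) → (Fin (d + 1) → ℤ) → Fin (d + 1) → (Fin (d + 1) → ℤ) → MKer (d + 1) (Fib d)) (P : ℕ → ℕ → (Fin (d + 1) → (Fin (d + 1) → ℤ) → Fin (d + 1) → (Fin (d + 1) → ℤ) → MKer (d + 1) (Fib d)) → Fin (d + 1) → (Fin (d + 1) → ℤ) → Fin (d + 1) → (Fin (d + 1) → ℤ) → MKer (d + 1) (Fib d)) (Zfree : (Fin (d + 1) → (Fin (d + 1) → ℤ) → Fin (d + 1) → (Fin (d + 1) → ℤ) → MKer (d + 1) (Fib d)) → Prop) (mom : (Fin (d + 1) → (Fin (d + 1) → ℤ) → Fin (d + 1) → (Fin (d + 1) → ℤ) → MKer (d + 1) (Fib d)) → ℝ)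
    {δin δT CT CT' ρ Cb C₀ : ℝ} (hCT' : 0 ≤ CT') (hρ0 : 0 ≤ ρ) (hρ1 : ρ < 1)
    (hsplit : ∀ n, T n = P 0 n (T 0) + ∑ i ∈ Finset.range n, P (i + 1) (n - 1 - i) (b i))
    (hTmarg : ∀ (m k : ℕ) (X : Fin (d + 1) → (Fin (d + 1) → ℤ) → Fin (d + 1) → (Fin (d + 1) → ℤ) → MKer (d + 1) (Fib d)) (C : ℝ), 0 ≤ C → LocStencil₂ X C δin → LocStencil₂ (P m k X) (CT * C) δT)
    (hTirr : ∀ (m k : ℕ) (X : Fin (d + 1) → (Fin (d + 1) → ℤ) → Fin (d + 1) → (Fin (d + 1) → ℤ) → MKer (d + 1) (Fib d)) (C : ℝ), 0 ≤ C → LocStencil₂ X C δin → Zfree X → mom X ≤ C →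
      LocStencil₂ (P m k X) (CT' * C * ρ ^ k) δT)
    (hb : ∀ m, LocStencil₂ (b m) Cb δin ∧ mom (b m) ≤ Cb) (hZ : ∀ m, Zfree (b m)) (h0 : LocStencil₂ (T 0) C₀ δin) (n : ℕ) :
    LocStencil₂ (T n) (CT * C₀ + CT' * Cb * (1 - ρ)⁻¹) δT := by
  have hC₀ : 0 ≤ C₀ := h0.nonneg
  have hCb : 0 ≤ Cb := (hb 0).1.nonneg
  rw [hsplit n]
  refine locStencil₂_add (hTmarg 0 n (T 0) C₀ hC₀ h0) (locStencil₂_mono (locStencil₂_sum (Finset.range n) _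
    (fun i => CT' * Cb * ρ ^ (n - 1 - i)) fun i _ => hTirr (i + 1) (n - 1 - i) (b i) Cb hCb (hb i).1 (hZ i) (hb i).2) ?_)
  rw [← Finset.mul_sum]
  exact mul_le_mul_of_nonneg_left (geom_reflect_sum_le hρ0 hρ1 n) (mul_nonneg hCT' hCb)

end Shape

/-! ## §2 END #2 (generic): the GEOMETRIC RATE of a zero-mode-free tower (the DIFFERENCE recursion) and its Cauchy form -/

section Rate

/-- [folklore] **END #2 OF ROAD «W3» (generic tower of differences).**  If `D n = P 0 n (D 0) + Σ_{i<n} P (i+1) (n−1−i) (f i)` with EVERY term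
zero-mode-free — the initial difference `D 0` ((F2)) and the forcing `f m` ((F2) `hZf`), the latter of size `C_f·θ^m` in shape AND first
moment ((F4) `hf`) —, and the transport is irrelevant on zero-mode-free tables ((F3) `hTirr`, gain `ρ^k`), then `D n` is a `LocStencil₂`
family with constant `c·ϑ^n` for some `c ≥ 0`, `ϑ ∈ (0, 1)` (any `ϑ > max ρ θ` works; Bernoulli's inequality absorbs the factor `n` of the
convolution `Σ_{i<n} ρ^{n−1−i} θ^i ≤ n·max^{n−1}`). -/
theorem rate_of_rows (D f : ℕ → Fin (d + 1) → (Fin (d + 1) → ℤ) → Fin (d + 1) → (Fin (d + 1) → ℤ) → MKer (d + 1) (Fib d)) (P : ℕ → ℕ → (Fin (d + 1) → (Fin (d + 1) → ℤ) → Fin (d + 1) → (Fin (d + 1) → ℤ) → MKer (d + 1) (Fib d)) → Fin (d + 1) → (Fin (d + 1) → ℤ) → Fin (d + 1) → (Fin (d + 1) → ℤ) → MKer (d + 1) (Fib d)) (Zfree : (Fin (d + 1) → (Fin (d + 1) → ℤ) → Fin (d + 1) → (Fin (d + 1) → ℤ) → MKer (d + 1) (Fib d)) → Prop) (mom : (Fin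 (d + 1) → (Fin (d + 1) → ℤ) → Fin (d + 1) → (Fin (d + 1) → ℤ) → MKer (d + 1) (Fib d)) → ℝ)
    {δin δT CT' ρ θ Cf C₀ : ℝ} (hCT' : 0 ≤ CT') (hρ0 : 0 ≤ ρ) (hρ1 : ρ < 1) (hθ0 : 0 ≤ θ) (hθ1 : θ < 1)
    (hsplit : ∀ n, D n = P 0 n (D 0) + ∑ i ∈ Finset.range n, P (i + 1) (n - 1 - i) (f i))
    (hTirr : ∀ (m k : ℕ) (X : Fin (d + 1) → (Fin (d + 1) → ℤ) → Fin (d + 1) → (Fin (d + 1) → ℤ) → MKer (d + 1) (Fib d)) (C : ℝ), 0 ≤ C → LocStencil₂ X C δin → Zfree X → mom X ≤ C →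
      LocStencil₂ (P m k X) (CT' * C * ρ ^ k) δT)
    (hf : ∀ m, LocStencil₂ (f m) (Cf * θ ^ m) δin ∧ mom (f m) ≤ Cf * θ ^ m) (hZf : ∀ m, Zfree (f m))
    (h0 : LocStencil₂ (D 0) C₀ δin ∧ mom (D 0) ≤ C₀) (hZ0 : Zfree (D 0)) :
    ∃ c ϑ : ℝ, 0 ≤ c ∧ 0 < ϑ ∧ ϑ < 1 ∧ ∀ n, LocStencil₂ (D n) (c * ϑ ^ n) δT := by
  have hC₀ : 0 ≤ C₀ := h0.1.nonneg
  have hCf : 0 ≤ Cf := by simpa using (hf 0).1.nonneg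
  set μ : ℝ := max ρ θ with hμ
  have hμ0 : 0 ≤ μ := le_max_of_le_left hρ0
  have hμ1 : μ < 1 := max_lt hρ1 hθ1
  obtain ⟨c₀, ϑ, hc₀, hϑ0, hϑ1, hμϑ, hdom⟩ := exists_geom_dominate hμ0 hμ1
  refine ⟨CT' * C₀ + CT' * Cf * c₀ * ϑ⁻¹, ϑ, by positivity, hϑ0, hϑ1, fun n => ?_⟩
  -- the raw bound
  have hraw : LocStencil₂ (D n) (CT' * C₀ * ρ ^ n + ∑ i ∈ Finset.range n, CT' * (Cf * θ ^ i) * ρ ^ (n - 1 - i)) δT := by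
    rw [hsplit n]
    exact locStencil₂_add (hTirr 0 n (D 0) C₀ hC₀ h0.1 hZ0 h0.2) (locStencil₂_sum (Finset.range n) _
      (fun i => CT' * (Cf * θ ^ i) * ρ ^ (n - 1 - i))
      fun i _ => hTirr (i + 1) (n - 1 - i) (f i) (Cf * θ ^ i) (by positivity) (hf i).1 (hZf i) (hf i).2)
  refine locStencil₂_mono hraw ?_
  -- first term: ρ^n ≤ μ^n ≤ ϑ^n
  have h1 : CT' * C₀ * ρ ^ n ≤ CT' * C₀ * ϑ ^ n :=
    mul_le_mul_of_nonneg_left (pow_le_pow_left₀ hρ0 ((le_max_left ρ θ).trans hμϑ) n) (mul_nonneg hCT' hC₀)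
  -- second term: Σ ≤ CT'·Cf·n·μ^{n−1} ≤ CT'·Cf·c₀·ϑ⁻¹·ϑ^n
  have hconv : ∑ i ∈ Finset.range n, ρ ^ (n - 1 - i) * θ ^ i ≤ c₀ * ϑ⁻¹ * ϑ ^ n := by
    refine (conv_sum_le hρ0 hθ0 n).trans ?_
    rcases n with _ | m
    · simp only [Nat.cast_zero, zero_mul]; positivity
    · rw [Nat.add_sub_cancel, pow_succ]
      calc ((m + 1 : ℕ) : ℝ) * μ ^ m = ((m : ℝ) + 1) * μ ^ m := by push_cast; ring
        _ ≤ c₀ * ϑ ^ m := hdom m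
        _ = c₀ * ϑ⁻¹ * (ϑ ^ m * ϑ) := by field_simp
  have h2 : ∑ i ∈ Finset.range n, CT' * (Cf * θ ^ i) * ρ ^ (n - 1 - i) ≤ CT' * Cf * c₀ * ϑ⁻¹ * ϑ ^ n := by
    have hsum : ∑ i ∈ Finset.range n, CT' * (Cf * θ ^ i) * ρ ^ (n - 1 - i) =
        CT' * Cf * ∑ i ∈ Finset.range n, ρ ^ (n - 1 - i) * θ ^ i := by
      rw [Finset.mul_sum]; refine Finset.sum_congr rfl fun i _ => by ring
    rw [hsum]
    calc CT' * Cf * ∑ i ∈ Finset.range n, ρ ^ (n - 1 - i) * θ ^ i ≤ CT' * Cf * (c₀ * ϑ⁻¹ * ϑ ^ n) :=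
          mul_le_mul_of_nonneg_left hconv (mul_nonneg hCT' hCf)
      _ = CT' * Cf * c₀ * ϑ⁻¹ * ϑ ^ n := by ring
  calc CT' * C₀ * ρ ^ n + ∑ i ∈ Finset.range n, CT' * (Cf * θ ^ i) * ρ ^ (n - 1 - i)
      ≤ CT' * C₀ * ϑ ^ n + CT' * Cf * c₀ * ϑ⁻¹ * ϑ ^ n := add_le_add h1 h2
    _ = (CT' * C₀ + CT' * Cf * c₀ * ϑ⁻¹) * ϑ ^ n := by ring

/-- [folklore] **CAUCHY FORM FROM THE ONE-STEP RATE** (telescoping + geometric series): if `T (n+1) − T n` is a `LocStencil₂` family with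
constant `c·ϑ^n`, then `T (k+j) − T k` is one with constant `c·(1−ϑ)⁻¹·ϑ^k`, for all `k j`. -/
theorem cauchy_of_rate (T : ℕ → Fin (d + 1) → (Fin (d + 1) → ℤ) → Fin (d + 1) → (Fin (d + 1) → ℤ) → MKer (d + 1) (Fib d)) {c ϑ δ : ℝ} (hc : 0 ≤ c) (hϑ0 : 0 ≤ ϑ) (hϑ1 : ϑ < 1)
    (h : ∀ n, LocStencil₂ (fun κ u κ' u' => T (n + 1) κ u κ' u' - T n κ u κ' u') (c * ϑ ^ n) δ) (k j : ℕ) :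
    LocStencil₂ (fun κ u κ' u' => T (k + j) κ u κ' u' - T k κ u κ' u') (c * (1 - ϑ)⁻¹ * ϑ ^ k) δ := by
  have htel : (fun κ u κ' u' => T (k + j) κ u κ' u' - T k κ u κ' u') =
      ∑ i ∈ Finset.range j, (fun κ u κ' u' => T (k + i + 1) κ u κ' u' - T (k + i) κ u κ' u') := by
    induction j with
    | zero =>
      rw [Finset.sum_range_zero]
      funext κ u κ' u'
      simp only [Nat.add_zero, sub_self, Pi.zero_apply]
    | succ j ih =>
      rw [Finset.sum_range_succ, ← ih]
      funext κ u κ' u'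
      simp only [Pi.add_apply, Nat.add_succ, sub_add_sub_cancel']
  rw [htel]
  refine locStencil₂_mono (locStencil₂_sum (Finset.range j) _ (fun i => c * ϑ ^ (k + i)) fun i _ => h (k + i)) ?_
  have hgeom : ∑ i ∈ Finset.range j, c * ϑ ^ (k + i) = c * ϑ ^ k * ∑ i ∈ Finset.range j, ϑ ^ i := by
    rw [Finset.mul_sum]; refine Finset.sum_congr rfl fun i _ => by rw [pow_add]; ring
  rw [hgeom]
  have hgs : ∑ i ∈ Finset.range j, ϑ ^ i ≤ (1 - ϑ)⁻¹ := by
    rw [← tsum_geometric_of_lt_one hϑ0 hϑ1]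
    exact (summable_geometric_of_lt_one hϑ0 hϑ1).sum_le_tsum (Finset.range j) fun i _ => pow_nonneg hϑ0 i
  calc c * ϑ ^ k * ∑ i ∈ Finset.range j, ϑ ^ i ≤ c * ϑ ^ k * (1 - ϑ)⁻¹ :=
        mul_le_mul_of_nonneg_left hgs (mul_nonneg hc (pow_nonneg hϑ0 k))
    _ = c * (1 - ϑ)⁻¹ * ϑ ^ k := by ring

/-- [folklore] From a `LocStencil₂` bound to the ENTRYWISE sup bound (rate `δ ≥ 0`): the shape of leaf-01's «T2SupRate». -/
theorem sup_of_locStencil₂ {X : Fin (d + 1) → (Fin (d + 1) → ℤ) → Fin (d + 1) → (Fin (d + 1) → ℤ) → MKer (d + 1) (Fib d)} {C δ : ℝ} (hδ : 0 ≤ δ) (h : LocStencil₂ X C δ)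
    (κ : Fin (d + 1)) (u : Fin (d + 1) → ℤ) (κ' : Fin (d + 1)) (u' x z : Fin (d + 1) → ℤ) (a b : Fib d) :
    |X κ u κ' u' x z a b| ≤ C := by
  have hC : 0 ≤ C := h.nonneg
  refine (h κ u κ' u' x z a b).trans ?_
  have e1 : Real.exp (-δ * l1 (u' - u)) ≤ 1 :=
    Real.exp_le_one_iff.2 (by nlinarith [l1_nonneg (u' - u)])
  have e2 : Real.exp (-δ * (l1 (x - u) + l1 (z - u))) ≤ 1 :=
    Real.exp_le_one_iff.2 (by nlinarith [l1_nonneg (x - u), l1_nonneg (z - u)])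
  calc C * Real.exp (-δ * l1 (u' - u)) * Real.exp (-δ * (l1 (x - u) + l1 (z - u)))
      ≤ C * 1 * 1 := by gcongr
    _ = C := by ring

end Rate


/-! ## §3 THE LITERAL W-SLOT SHAPES for an2's Stage-B tables (the texts the wall's consumers bind, UNDER THE PIN) -/

section Literal

variable {Lc : ℕ} [NeZero Lc]

/-- **«T2Shape» AS A FUNCTION OF THE FIVE ROW FAMILIES OF ROAD «W3»** (END #1 instantiated): for an2's Stage-B bi-stencil family
`T2Of d Lc cE cVH cΛ cE₂ cB Tc (vh₂S d Lc) mixFF` normalised by `unitS₂ (sfStep Lc j) (smStep d Lc j)` (leaf-19's `T2SlotUnits` currency), the rows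
(F1) `hsplit`, (F3) `hTmarg` — stated UNDER THE PIN `|cE₂| ≤ Lc^{2(d+1)}`, which this END therefore CARRIES as `hpin` (ref2 r47 (r)) — and
`hTirr`, (F2) `hZ`, (F4) `hb`, and the shape `h0` of member `0` (an3's `biLoc_wilsonW₂` + an1's border: leaf-19's
`T2SlotOfHW.locStencil₂_unitS₂_T2Of_zero`) give LITERALLY the binder `hT₂` of leaf-07's `WSlotOfShapes.hW_of_shapes` ∕ the «T2Shape» side of
leaf-19's `T2SlotOfHW.hW_iff_t2Shape` at `T₂ := T2Of … (vh₂S d Lc) mixFF`.  [folklore] composition (`shape_of_rows`). -/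
theorem t2Shape_of_rows (cE cVH cΛ cE₂ cB : ℝ) (Tc : Fin 4 → Fin 4 → Fin 4 → Fin 4 → ℝ)
    (mixFF : Fin (d + 1) → (Fin (d + 1) → ℤ) → Fin (d + 1) → (Fin (d + 1) → ℤ) → MKer (d + 1) (Fib d))
    (b : ℕ → Fin (d + 1) → (Fin (d + 1) → ℤ) → Fin (d + 1) → (Fin (d + 1) → ℤ) → MKer (d + 1) (Fib d))
    (P : ℕ → ℕ → (Fin (d + 1) → (Fin (d + 1) → ℤ) → Fin (d + 1) → (Fin (d + 1) → ℤ) → MKer (d + 1) (Fib d)) → Fin (d + 1) → (Fin (d + 1) → ℤ) → Fin (d + 1) → (Fin (d + 1) → ℤ) → MKer (d + 1) (Fib d))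
    (Zfree : (Fin (d + 1) → (Fin (d + 1) → ℤ) → Fin (d + 1) → (Fin (d + 1) → ℤ) → MKer (d + 1) (Fib d)) → Prop)
    (mom : (Fin (d + 1) → (Fin (d + 1) → ℤ) → Fin (d + 1) → (Fin (d + 1) → ℤ) → MKer (d + 1) (Fib d)) → ℝ)
    {δin δT CT CT' ρ Cb C₀ : ℝ} (hδT : 0 < δT) (hCT' : 0 ≤ CT') (hρ0 : 0 ≤ ρ) (hρ1 : ρ < 1)
    (hpin : |cE₂| ≤ (Lc : ℝ) ^ (2 * (d + 1)))
    (hsplit : ∀ n, unitS₂ (sfStep Lc n) (smStep d Lc n) (T2Of d Lc cE cVH cΛ cE₂ cB Tc (vh₂S d Lc) mixFF n) =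
      P 0 n (unitS₂ (sfStep Lc 0) (smStep d Lc 0) (T2Of d Lc cE cVH cΛ cE₂ cB Tc (vh₂S d Lc) mixFF 0)) + ∑ i ∈ Finset.range n, P (i + 1) (n - 1 - i) (b i))
    (hTmarg : |cE₂| ≤ (Lc : ℝ) ^ (2 * (d + 1)) → ∀ (m k : ℕ) (X : Fin (d + 1) → (Fin (d + 1) → ℤ) → Fin (d + 1) → (Fin (d + 1) → ℤ) → MKer (d + 1) (Fib d)) (C : ℝ),
      0 ≤ C → LocStencil₂ X C δin → LocStencil₂ (P m k X) (CT * C) δT)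
    (hTirr : ∀ (m k : ℕ) (X : Fin (d + 1) → (Fin (d + 1) → ℤ) → Fin (d + 1) → (Fin (d + 1) → ℤ) → MKer (d + 1) (Fib d)) (C : ℝ),
      0 ≤ C → LocStencil₂ X C δin → Zfree X → mom X ≤ C → LocStencil₂ (P m k X) (CT' * C * ρ ^ k) δT)
    (hb : ∀ m, LocStencil₂ (b m) Cb δin ∧ mom (b m) ≤ Cb) (hZ : ∀ m, Zfree (b m))
    (h0 : LocStencil₂ (unitS₂ (sfStep Lc 0) (smStep d Lc 0) (T2Of d Lc cE cVH cΛ cE₂ cB Tc (vh₂S d Lc) mixFF 0)) C₀ δin) :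
    ∃ C₂ δ₂ : ℝ, 0 < δ₂ ∧ ∀ j, LocStencil₂ (unitS₂ (sfStep Lc j) (smStep d Lc j) (T2Of d Lc cE cVH cΛ cE₂ cB Tc (vh₂S d Lc) mixFF j)) C₂ δ₂ :=
  ⟨CT * C₀ + CT' * Cb * (1 - ρ)⁻¹, δT, hδT,
    shape_of_rows (fun n => unitS₂ (sfStep Lc n) (smStep d Lc n) (T2Of d Lc cE cVH cΛ cE₂ cB Tc (vh₂S d Lc) mixFF n)) b P Zfree mom hCT' hρ0 hρ1 hsplit (hTmarg hpin) hTirr hb hZ h0⟩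

/-- **«T2Drift» ∕ «T2SupRate» AS A FUNCTION OF THE ROW FAMILIES OF ROAD «W3»** (END #2 instantiated): for the one-step DIFFERENCES
`D n := T♮_{n+1} − T♮_n` of the normalised family, unrolled through the (shifted) transport `P` with zero-mode-free forcing `f` of geometric
size `C_f·θ^m` ((F1) `hsplit`, (F2) `hZf`∕`hZ0`, (F3) `hTirr`, (F4) `hf`∕`h0`): ONE-STEP form `∀ n, LocStencil₂ D_n (c·ϑ^n) δ_T`, CAUCHY form
`∀ k j, LocStencil₂ (T♮_{k+j} − T♮_k) (c·(1−ϑ)⁻¹·ϑ^k) δ_T` (the «T2Drift» text, the `hW₂all`-side input of leaf-07's Cauchy plug), and the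
ENTRYWISE sup-rate `|T♮_{n+1} − T♮_n| ≤ c·ϑ^n` (leaf-01's «T2SupRate», `WSlotSupRate` route).  No pin is needed on the difference tower
(every term is zero-mode-free: only the IRRELEVANT transport row enters).  [folklore] composition (`rate_of_rows`, `cauchy_of_rate`). -/
theorem t2Drift_of_rows (cE cVH cΛ cE₂ cB : ℝ) (Tc : Fin 4 → Fin 4 → Fin 4 → Fin 4 → ℝ)
    (mixFF : Fin (d + 1) → (Fin (d + 1) → ℤ) → Fin (d + 1) → (Fin (d + 1) → ℤ) → MKer (d + 1) (Fib d))
    (f : ℕ → Fin (d + 1) → (Fin (d + 1) → ℤ) → Fin (d + 1) → (Fin (d + 1) → ℤ) → MKer (d + 1) (Fib d))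
    (P : ℕ → ℕ → (Fin (d + 1) → (Fin (d + 1) → ℤ) → Fin (d + 1) → (Fin (d + 1) → ℤ) → MKer (d + 1) (Fib d)) → Fin (d + 1) → (Fin (d + 1) → ℤ) → Fin (d + 1) → (Fin (d + 1) → ℤ) → MKer (d + 1) (Fib d))
    (Zfree : (Fin (d + 1) → (Fin (d + 1) → ℤ) → Fin (d + 1) → (Fin (d + 1) → ℤ) → MKer (d + 1) (Fib d)) → Prop)
    (mom : (Fin (d + 1) → (Fin (d + 1) → ℤ) → Fin (d + 1) → (Fin (d + 1) → ℤ) → MKer (d + 1) (Fib d)) → ℝ)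
    {δin δT CT' ρ θ Cf C₀ : ℝ} (hδT : 0 < δT) (hCT' : 0 ≤ CT') (hρ0 : 0 ≤ ρ) (hρ1 : ρ < 1) (hθ0 : 0 ≤ θ) (hθ1 : θ < 1)
    (hsplit : ∀ n, (fun κ u κ' u' => unitS₂ (sfStep Lc (n + 1)) (smStep d Lc (n + 1)) (T2Of d Lc cE cVH cΛ cE₂ cB Tc (vh₂S d Lc) mixFF (n + 1)) κ u κ' u' - unitS₂ (sfStep Lc n) (smStep d Lc n) (T2Of d Lc cE cVH cΛ cE₂ cB Tc (vh₂S d Lc) mixFF n) κ u κ' u') =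
      P 0 n (fun κ u κ' u' => unitS₂ (sfStep Lc 1) (smStep d Lc 1) (T2Of d Lc cE cVH cΛ cE₂ cB Tc (vh₂S d Lc) mixFF 1) κ u κ' u' - unitS₂ (sfStep Lc 0) (smStep d Lc 0) (T2Of d Lc cE cVH cΛ cE₂ cB Tc (vh₂S d Lc) mixFF 0) κ u κ' u')
        + ∑ i ∈ Finset.range n, P (i + 1) (n - 1 - i) (f i))
    (hTirr : ∀ (m k : ℕ) (X : Fin (d + 1) → (Fin (d + 1) → ℤ) → Fin (d + 1) → (Fin (d + 1) → ℤ) → MKer (d + 1) (Fib d)) (C : ℝ),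
      0 ≤ C → LocStencil₂ X C δin → Zfree X → mom X ≤ C → LocStencil₂ (P m k X) (CT' * C * ρ ^ k) δT)
    (hf : ∀ m, LocStencil₂ (f m) (Cf * θ ^ m) δin ∧ mom (f m) ≤ Cf * θ ^ m) (hZf : ∀ m, Zfree (f m))
    (h0 : LocStencil₂ (fun κ u κ' u' => unitS₂ (sfStep Lc 1) (smStep d Lc 1) (T2Of d Lc cE cVH cΛ cE₂ cB Tc (vh₂S d Lc) mixFF 1) κ u κ' u' - unitS₂ (sfStep Lc 0) (smStep d Lc 0) (T2Of d Lc cE cVH cΛ cE₂ cB Tc (vh₂S d Lc) mixFF 0) κ u κ' u') C₀ δin ∧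
      mom (fun κ u κ' u' => unitS₂ (sfStep Lc 1) (smStep d Lc 1) (T2Of d Lc cE cVH cΛ cE₂ cB Tc (vh₂S d Lc) mixFF 1) κ u κ' u' - unitS₂ (sfStep Lc 0) (smStep d Lc 0) (T2Of d Lc cE cVH cΛ cE₂ cB Tc (vh₂S d Lc) mixFF 0) κ u κ' u') ≤ C₀)
    (hZ0 : Zfree (fun κ u κ' u' => unitS₂ (sfStep Lc 1) (smStep d Lc 1) (T2Of d Lc cE cVH cΛ cE₂ cB Tc (vh₂S d Lc) mixFF 1) κ u κ' u' - unitS₂ (sfStep Lc 0) (smStep d Lc 0) (T2Of d Lc cE cVH cΛ cE₂ cB Tc (vh₂S d Lc) mixFF 0) κ u κ' u')) :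
    ∃ c ϑ : ℝ, 0 ≤ c ∧ 0 < ϑ ∧ ϑ < 1 ∧
      (∀ n, LocStencil₂ (fun κ u κ' u' => unitS₂ (sfStep Lc (n + 1)) (smStep d Lc (n + 1)) (T2Of d Lc cE cVH cΛ cE₂ cB Tc (vh₂S d Lc) mixFF (n + 1)) κ u κ' u' - unitS₂ (sfStep Lc n) (smStep d Lc n) (T2Of d Lc cE cVH cΛ cE₂ cB Tc (vh₂S d Lc) mixFF n) κ u κ' u') (c * ϑ ^ n) δT) ∧
      (∀ k j, LocStencil₂ (fun κ u κ' u' => unitS₂ (sfStep Lc (k + j)) (smStep d Lc (k + j)) (T2Of d Lc cE cVH cΛ cE₂ cB Tc (vh₂S d Lc) mixFF (k + j)) κ u κ' u' - unitS₂ (sfStep Lc k) (smStep d Lc k) (T2Of d Lc cE cVH cΛ cE₂ cB Tc (vh₂S d Lc) mixFF k) κ u κ' u') (c * (1 - ϑ)⁻¹ * ϑ ^ k) δT) ∧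
      (∀ n κ u κ' u' x z a b, |unitS₂ (sfStep Lc (n + 1)) (smStep d Lc (n + 1)) (T2Of d Lc cE cVH cΛ cE₂ cB Tc (vh₂S d Lc) mixFF (n + 1)) κ u κ' u' x z a b - unitS₂ (sfStep Lc n) (smStep d Lc n) (T2Of d Lc cE cVH cΛ cE₂ cB Tc (vh₂S d Lc) mixFF n) κ u κ' u' x z a b| ≤ c * ϑ ^ n) := by
  obtain ⟨c, ϑ, hc, hϑ0, hϑ1, hD⟩ := rate_of_rows
    (fun n => fun κ u κ' u' => unitS₂ (sfStep Lc (n + 1)) (smStep d Lc (n + 1)) (T2Of d Lc cE cVH cΛ cE₂ cB Tc (vh₂S d Lc) mixFF (n + 1)) κ u κ' u' - unitS₂ (sfStep Lc n) (smStep d Lc n) (T2Of d Lc cE cVH cΛ cE₂ cB Tc (vh₂S d Lc) mixFF n) κ u κ' u')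
    f P Zfree mom hCT' hρ0 hρ1 hθ0 hθ1 hsplit hTirr hf hZf h0 hZ0
  refine ⟨c, ϑ, hc, hϑ0, hϑ1, hD, fun k j => ?_, fun n κ u κ' u' x z a b => ?_⟩
  · exact cauchy_of_rate (fun n => unitS₂ (sfStep Lc n) (smStep d Lc n) (T2Of d Lc cE cVH cΛ cE₂ cB Tc (vh₂S d Lc) mixFF n)) hc hϑ0.le hϑ1 hD k j
  · exact sup_of_locStencil₂ hδT.le (hD n) κ u κ' u' x z a b

end Literal

end Summit.QuantumFields.BalabanUV.Beta.GAN24.WSlotT2OfPieces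

end
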